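import Literature.NumberTheory.K2Lit.QuaternionLocalNormOne                      -- ★ p855160 leaf #3c: `localReducedNorm`, `reducedNormUnits`, `mem_range_reducedNormUnits_iff`
import Literature.NumberTheory.Automorphic.QuaternionInvolutionToolkit             -- ★ `reducedNorm_algebraMap` (`n(c) = c²`)
import Literature.NumberTheory.QuadraticForms.HilbertSymbolLocalQuinary           -- ★ `exists_quinary_zero` (Serre IV §2.2 Thm. 6 (iv) over `K_v`), ★ `neZero_two_adicCompletion`
import Literature.NumberTheory.QuadraticForms.IsotropicRankFive                   -- ★ `exists_sum_mul_sq_eq_of_isotropic` (isotropic ⇒ universal)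
import Literature.NumberTheory.QuadraticForms.GlobalSquareTheorem                 -- ★ `isSquare_of_valued_sub_one_lt` (`1 + 4𝔪_v ⊆ K_v²`)
import Mathlib.NumberTheory.NumberField.Completion.FinitePlace                    -- `instNormedFieldValuedAdicCompletion` (norm on `K_v`)
import HarnessLib

/-!
# K2 ∕ E5 — ★ K2Lit follow-on #3h «the local reduced norm `n : H_vˣ → K_vˣ` is SURJECTIVE and OPEN at every finite place»

Cell `hodgecm-mathlib`, Track B «K2-LIT», engine E5 «Tamagawa numbers ∕ volumes of unitary groups»; crux item h413 = `stmt-HodgeConjecture-24833`;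
author K2E5-p14 (g0), dealt BY NAME by K2E5-plan (g0) (E5 BATCH #4 (f), 2026-09-03T22:19:27Z).  Local input of the `Nrd`-descent of unit G (ZETA) of the line
`Cruxes/H413/Lines/K2_E5_TamagawaUnitary.lean` (the generic ★ A5 `haarKerPinRescale` ∕ ★ A7 `haarCovolTower` need `φ = Nrd` continuous, OPEN and SURJECTIVE);
the global counterpart is ★ D4 Eichler.  Namespace `Literature.NumberTheory.K2Lit.QuaternionLocalNormOneSurjective` (directory rule).  Theorems only: no `sorry`,
no axiom beyond the trio, no `instance`, no notation, no named fact.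

Content, for a quaternion algebra `D` over a number field `K` (★ `IsQuaternionAlgebra K D`), a FINITE place `v`, `K_v = v.adicCompletion K`,
`H_v = K_v ⊗_K D` (★ `ScalarExtension`), `n = localReducedNorm K D v : H_vˣ →* K_vˣ` (★ leaf #3c):
* §1 `exists_quaternary_eq` — **every non-degenerate diagonal quaternary form over `K_v` is universal**: `a₁y₁² + a₂y₂² + a₃y₃² + a₄y₄² = t` is solvable for
  every `t` ([Serre1973, Ch. IV §2.2 Thm. 6 (iv) + Cor.]: the quinary form `⟨a₁,…,a₄,−t⟩` has a non-trivial zero (★ `exists_quinary_zero`); either its last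
  coordinate is invertible, or `⟨a₁,…,a₄⟩` is isotropic, hence universal (★ `exists_sum_mul_sq_eq_of_isotropic`));
* §2 `exists_reducedNorm_eq` — **every `t ∈ K_v` is a reduced norm** from any quaternion algebra `A` over `K_v` (`A ≃ ℍ[K_v,a,b]`, ★
  `IsQuaternionAlgebra.exists_algEquiv_quaternionAlgebra`; the norm form `x² − a y² − b z² + ab w²`, ★ `reducedNorm_quaternionAlgebra`, is a non-degenerate
  diagonal quaternary form);  [VignerasLNM800, Ch. II §1 p. 31 (3), Lemme 1.4: `n(H_vˣ) = K_vˣ` at a finite place, division case included];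
* §3 `localReducedNorm_surjective`, `range_localReducedNorm`; `exists_sq_eq_of_norm_sub_one_lt` (square roots NEAR `1`: `‖u − 1‖ < ‖4‖ ⇒ u = β²` with
  `‖2‖·‖β − 1‖ ≤ ‖u − 1‖`, from ★ `isSquare_of_valued_sub_one_lt` = [Omeara1963, §63A Cor. 63:1b] and the ultrametric `±β` choice), `localReducedNorm_unitsMap_algebraMap`
  (`n(c·1) = c²`), and **`isOpenMap_localReducedNorm`**: by Mathlib `IsTopologicalGroup.isOpenMap_iff_nhds_one` it suffices that `n(U)` is a neighbourhood of
  `1` for every neighbourhood `U` of `1 ∈ H_vˣ`; pulling `U` back along the continuous scalar embedding `ι : K_vˣ → H_vˣ` gives a ball `‖c − 1‖ < ε`, and every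
  `u` with `‖u − 1‖ < min(‖4‖, ‖2‖ε)` is `β²` with `‖β − 1‖ < ε`, so `u = n(ι β) ∈ n(U)`.

HONEST LABEL: HC_CM is proved only modulo the 7 printed citations (2 remaining named inputs: hLiu418 = stmt-HodgeConjecture-24832,
h413 = stmt-HodgeConjecture-24833) until rung 0 closes; this file asserts nothing toward any count (local arithmetic of quaternion algebras only).

AUDIT (materialised pages; corpus key `book:vignerasnd-arithmetique-des-algebres-de-quaternions` = V80): V80 p0031.txt:L33 «On définit une application
w: H* → ℤ en posant si h ∈ H*, (3) w(h) = v∘n(h)»; p0032.txt:L1–3 «où n: H* → K* est la norme réduite … LEMME 1.4. L'application w est une valuation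
discrète de H»; p0053.txt:L19–22 «c) G_v = H¹_v … où x¹ désigne le noyau de la norme réduite».

## References
* [VignerasLNM800] M.-F. Vignéras, *Arithmétique des algèbres de quaternions*, Lecture Notes in Math. 800, Springer 1980 — Ch. II §1 p. 31 (3), Lemme 1.4; Ch. III §1 p. 52 (c).
* [Serre1973] J.-P. Serre, *A Course in Arithmetic*, GTM 7, Springer 1973 — Ch. IV §2.2 Thm. 6 (iv) and its Corollary (forms of rank `≥ 4` over `ℚ_p`∕`K_v` represent everything).
* [Omeara1963] O. T. O'Meara, *Introduction to Quadratic Forms*, Springer 1963 — §63A (local square theorem, Cor. 63:1b).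
-/

set_option autoImplicit false

noncomputable section

open NumberField IsDedekindDomain Filter
open _root_.Topology
open Literature.NumberTheory.Automorphic Literature.NumberTheory.QuadraticForms
open Literature.NumberTheory.K2Lit.QuaternionLocalNormOne

universe u

namespace Literature.NumberTheory.K2Lit.QuaternionLocalNormOneSurjective

/-! ## 1. Non-degenerate diagonal quaternary forms over `K_v` are universal -/

section Quaternary

variable (K : Type) [Field K] [NumberField K] (v : HeightOneSpectrum (𝓞 K))

/-- **Quaternary forms over `K_v` are universal**: for `a₁ a₂ a₃ a₄ ∈ K_vˣ` and any `t ∈ K_v` the equation `a₁y₁² + a₂y₂² + a₃y₃² + a₄y₄² = t` has a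
solution — the quinary form `⟨a₁, a₂, a₃, a₄, −t⟩` represents `0` non-trivially (★ `exists_quinary_zero`); if the last coordinate of the zero vanishes, the
quaternary form is isotropic and therefore universal (★ `exists_sum_mul_sq_eq_of_isotropic`). [cite: Serre1973, Ch. IV §2.2 Thm. 6 (iv), Cor.] -/
theorem exists_quaternary_eq {a₁ a₂ a₃ a₄ : v.adicCompletion K} (h₁ : a₁ ≠ 0) (h₂ : a₂ ≠ 0) (h₃ : a₃ ≠ 0) (h₄ : a₄ ≠ 0)
    (t : v.adicCompletion K) :
    ∃ y₁ y₂ y₃ y₄ : v.adicCompletion K, a₁ * y₁ ^ 2 + a₂ * y₂ ^ 2 + a₃ * y₃ ^ 2 + a₄ * y₄ ^ 2 = t := by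
  by_cases ht : t = 0
  · exact ⟨0, 0, 0, 0, by rw [ht]; ring⟩
  obtain ⟨x, hx0, hx⟩ := exists_quinary_zero K v h₁ h₂ h₃ h₄ (neg_ne_zero.2 ht)
  by_cases hx4 : x 4 = 0
  · -- the quaternary form `⟨a₁, a₂, a₃, a₄⟩` is isotropic, hence universal
    have h2 : (2 : v.adicCompletion K) ≠ 0 := (neZero_two_adicCompletion K v).ne
    let c : Fin 4 → v.adicCompletion K := ![a₁, a₂, a₃, a₄]
    have hc : ∀ i, c i ≠ 0 := by
      intro i
      fin_cases i
      · exact h₁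
      · exact h₂
      · exact h₃
      · exact h₄
    let x' : Fin 4 → v.adicCompletion K := ![x 0, x 1, x 2, x 3]
    have hx'0 : x' ≠ 0 := by
      intro h
      apply hx0
      funext i
      fin_cases i
      · simpa [x'] using congrFun h 0
      · simpa [x'] using congrFun h 1
      · simpa [x'] using congrFun h 2
      · simpa [x'] using congrFun h 3
      · exact hx4
    have hx' : ∑ i, c i * x' i ^ 2 = 0 := by
      simp only [Fin.sum_univ_four, c, x', Matrix.cons_val_zero, Matrix.cons_val_one, Matrix.cons_val]
      rw [hx4] at hx
      linear_combination hx
    obtain ⟨y, hy⟩ := exists_sum_mul_sq_eq_of_isotropic h2 hc hx'0 hx' t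
    refine ⟨y 0, y 1, y 2, y 3, ?_⟩
    simpa only [Fin.sum_univ_four, c, Matrix.cons_val_zero, Matrix.cons_val_one, Matrix.cons_val] using hy
  · refine ⟨x 0 / x 4, x 1 / x 4, x 2 / x 4, x 3 / x 4, ?_⟩
    field_simp
    linear_combination hx

end Quaternary

/-! ## 2. Every element of `K_v` is a reduced norm -/

section LocalQuaternion

variable (K : Type) [Field K] [NumberField K] (v : HeightOneSpectrum (𝓞 K))
  (A : Type*) [Ring A] [Algebra (v.adicCompletion K) A] [IsQuaternionAlgebra (v.adicCompletion K) A]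

/-- **Every `t ∈ K_v` is a reduced norm from a quaternion algebra `A` over `K_v`** (finite place `v`; split AND division case): `A ≃ ℍ[K_v,a,b]` (★
`IsQuaternionAlgebra.exists_algEquiv_quaternionAlgebra`), the norm form `x² − a y² − b z² + ab w²` (★ `reducedNorm_quaternionAlgebra`) is a non-degenerate
diagonal quaternary form, universal by `exists_quaternary_eq`, and `n` is transported along the isomorphism (★ `reducedNorm_algEquiv`).
[cite: VignerasLNM800, Ch. II §1 p. 31 (3); Lemme 1.4] [cite: Serre1973, Ch. IV §2.2 Thm. 6 (iv), Cor.] -/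
theorem exists_reducedNorm_eq (t : v.adicCompletion K) : ∃ x : A, reducedNorm (v.adicCompletion K) A x = t := by
  haveI := neZero_two_adicCompletion K v
  obtain ⟨a, b, ha, hb, ⟨e⟩⟩ := IsQuaternionAlgebra.exists_algEquiv_quaternionAlgebra (v.adicCompletion K) A
  obtain ⟨y₁, y₂, y₃, y₄, hy⟩ :=
    exists_quaternary_eq K v (a₁ := 1) (a₂ := -a) (a₃ := -b) (a₄ := a * b) one_ne_zero (neg_ne_zero.2 ha) (neg_ne_zero.2 hb) (mul_ne_zero ha hb) t
  refine ⟨e.symm ⟨y₁, y₂, y₃, y₄⟩, ?_⟩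
  rw [← reducedNorm_algEquiv e, AlgEquiv.apply_symm_apply, reducedNorm_quaternionAlgebra]
  linear_combination hy

end LocalQuaternion

/-! ## 3. `n : H_vˣ → K_vˣ` is surjective and open -/

section Local

variable (K : Type) [Field K] [NumberField K] (D : Type u) [Ring D] [Algebra K D] [IsQuaternionAlgebra K D]
  (v : HeightOneSpectrum (𝓞 K))

/-- **The local reduced norm `n : H_vˣ → K_vˣ` is SURJECTIVE at every finite place** (`n(H_vˣ) = K_vˣ`): every `c ∈ K_vˣ` is `n(x)` for some `x ∈ H_v`
(`exists_reducedNorm_eq`), and `x` is then a unit (★ `mem_range_reducedNormUnits_iff`). [cite: VignerasLNM800, Ch. II §1 p. 31 (3); Lemme 1.4] -/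
theorem localReducedNorm_surjective : Function.Surjective (localReducedNorm K D v) := by
  haveI : CharZero (v.adicCompletion K) := charZero_of_injective_algebraMap (algebraMap K (v.adicCompletion K)).injective
  haveI := isQuaternionAlgebra_completion K D v
  intro c
  obtain ⟨x, hx⟩ := exists_reducedNorm_eq K v (ScalarExtension K (v.adicCompletion K) D) (c : v.adicCompletion K)
  obtain ⟨w, hw⟩ := (mem_range_reducedNormUnits_iff (v.adicCompletion K) (ScalarExtension K (v.adicCompletion K) D) c).2 ⟨x, hx⟩
  exact ⟨w, hw⟩

/-- `n(H_vˣ) = K_vˣ` as an equality of subgroups. [cite: VignerasLNM800, Ch. II §1 p. 31 (3); Lemme 1.4] -/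
theorem range_localReducedNorm : (localReducedNorm K D v).range = ⊤ :=
  MonoidHom.range_eq_top.2 (localReducedNorm_surjective K D v)

/-- **`n` on scalars**: for `c ∈ K_vˣ`, `n(c · 1) = c²` (★ `reducedNorm_algebraMap`). [cite: VignerasLNM800, Ch. I §1 Lemme 1.1] -/
theorem localReducedNorm_unitsMap_algebraMap (c : (v.adicCompletion K)ˣ) :
    localReducedNorm K D v
        (Units.map (algebraMap (v.adicCompletion K) (ScalarExtension K (v.adicCompletion K) D)).toMonoidHom c) = c ^ 2 := by
  haveI : CharZero (v.adicCompletion K) := charZero_of_injective_algebraMap (algebraMap K (v.adicCompletion K)).injective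
  haveI := isQuaternionAlgebra_completion K D v
  refine Units.ext ?_
  rw [coe_localReducedNorm, Units.coe_map, RingHom.toMonoidHom_eq_coe, MonoidHom.coe_coe, Units.val_pow_eq_pow_val,
    reducedNorm_algebraMap]

/-- **Square roots near `1` in `K_v`** (norm form): if `‖u − 1‖ < ‖4‖` then `u = β²` with `‖2‖·‖β − 1‖ ≤ ‖u − 1‖` — `u` is a square by the local square
theorem (★ `isSquare_of_valued_sub_one_lt`: `1 + 4𝔪_v ⊆ K_v²`), and of the two roots `±s`, `(s − 1)(s + 1) = u − 1` with `‖2‖ ≤ max(‖s − 1‖, ‖s + 1‖)`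
(ultrametric), so the root whose cofactor is the larger one works. [cite: Omeara1963, §63A Cor. 63:1b] -/
theorem exists_sq_eq_of_norm_sub_one_lt {u : v.adicCompletion K} (hu : ‖u - 1‖ < ‖(4 : v.adicCompletion K)‖) :
    ∃ β : v.adicCompletion K, β ^ 2 = u ∧ ‖(2 : v.adicCompletion K)‖ * ‖β - 1‖ ≤ ‖u - 1‖ := by
  have hv : Valued.v (u - 1) < Valued.v (4 : v.adicCompletion K) := Valued.toNormedField.norm_lt_iff.1 hu
  obtain ⟨s, hs⟩ := isSquare_of_valued_sub_one_lt K v hv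
  have hprod : ‖s - 1‖ * ‖s + 1‖ = ‖u - 1‖ := by
    rw [← norm_mul, hs]
    ring_nf
  have h2le : ‖(2 : v.adicCompletion K)‖ ≤ max ‖s + 1‖ ‖s - 1‖ := by
    have e : (2 : v.adicCompletion K) = (s + 1) + (1 - s) := by ring
    rw [e, norm_sub_rev s 1]
    exact IsUltrametricDist.norm_add_le_max _ _
  rcases le_total ‖s - 1‖ ‖s + 1‖ with h | h
  · refine ⟨s, by rw [hs, pow_two], ?_⟩
    have h2 : ‖(2 : v.adicCompletion K)‖ ≤ ‖s + 1‖ := h2le.trans (max_le le_rfl h)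
    calc ‖(2 : v.adicCompletion K)‖ * ‖s - 1‖ ≤ ‖s + 1‖ * ‖s - 1‖ := mul_le_mul_of_nonneg_right h2 (norm_nonneg _)
      _ = ‖u - 1‖ := by rw [mul_comm, hprod]
  · refine ⟨-s, by rw [hs]; ring, ?_⟩
    have h2 : ‖(2 : v.adicCompletion K)‖ ≤ ‖s - 1‖ := h2le.trans (max_le h le_rfl)
    have e : ‖-s - 1‖ = ‖s + 1‖ := by
      rw [show -s - 1 = -(s + 1) by ring, norm_neg]
    calc ‖(2 : v.adicCompletion K)‖ * ‖-s - 1‖ = ‖(2 : v.adicCompletion K)‖ * ‖s + 1‖ := by rw [e]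
      _ ≤ ‖s - 1‖ * ‖s + 1‖ := mul_le_mul_of_nonneg_right h2 (norm_nonneg _)
      _ = ‖u - 1‖ := hprod

/-- **The local reduced norm `n : H_vˣ → K_vˣ` is an OPEN MAP** at every finite place.  By Mathlib `IsTopologicalGroup.isOpenMap_iff_nhds_one` it is enough
that `n(U)` is a neighbourhood of `1` for every neighbourhood `U` of `1 ∈ H_vˣ`: the scalar embedding `ι : K_vˣ → H_vˣ` is continuous, so `ι⁻¹ U` contains
`{c : ‖c − 1‖ < ε}`; then every `u` with `‖u − 1‖ < min(‖4‖, ‖2‖ε)` is `β²` with `‖β − 1‖ < ε` (`exists_sq_eq_of_norm_sub_one_lt`), i.e. `u = n(ι β) ∈ n(U)`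
(`localReducedNorm_unitsMap_algebraMap`). [cite: VignerasLNM800, Ch. II §1 p. 31 (3); Lemme 1.4] [cite: Omeara1963, §63A Cor. 63:1b] -/
theorem isOpenMap_localReducedNorm : IsOpenMap (localReducedNorm K D v) := by
  haveI : CharZero (v.adicCompletion K) := charZero_of_injective_algebraMap (algebraMap K (v.adicCompletion K)).injective
  haveI := isQuaternionAlgebra_completion K D v
  -- the scalar embedding `ι : K_vˣ →* H_vˣ`
  let ι : (v.adicCompletion K)ˣ →* completionUnits D v :=
    Units.map (algebraMap (v.adicCompletion K) (ScalarExtension K (v.adicCompletion K) D)).toMonoidHom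
  have hι : Continuous ι :=
    Continuous.units_map _ (continuous_algebraMap (v.adicCompletion K) (ScalarExtension K (v.adicCompletion K) D))
  rw [IsTopologicalGroup.isOpenMap_iff_nhds_one]
  intro S hS
  rw [Filter.mem_map] at hS
  -- pull the neighbourhood back along `ι` and read it as a ball of `K_v`
  have h1 : ι ⁻¹' (localReducedNorm K D v ⁻¹' S) ∈ 𝓝 (1 : (v.adicCompletion K)ˣ) := by
    have h := hι.tendsto (1 : (v.adicCompletion K)ˣ)
    rw [map_one] at h
    exact h hS
  rw [Units.isEmbedding_val₀.nhds_eq_comap, Filter.mem_comap] at h1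
  obtain ⟨V, hV, hVsub⟩ := h1
  rw [Units.val_one] at hV
  obtain ⟨ε, hε, hball⟩ := Metric.mem_nhds_iff.1 hV
  have h2 : (2 : v.adicCompletion K) ≠ 0 := two_ne_zero
  have h4 : (4 : v.adicCompletion K) ≠ 0 := by norm_num
  set δ : ℝ := min ‖(4 : v.adicCompletion K)‖ (‖(2 : v.adicCompletion K)‖ * ε) with hδ
  have hδ0 : 0 < δ := lt_min (norm_pos_iff.2 h4) (mul_pos (norm_pos_iff.2 h2) hε)
  have hT : (Units.val ⁻¹' Metric.ball (1 : v.adicCompletion K) δ : Set (v.adicCompletion K)ˣ) ∈ 𝓝 (1 : (v.adicCompletion K)ˣ) :=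
    (Metric.isOpen_ball.preimage Units.continuous_val).mem_nhds (by
      rw [Set.mem_preimage, Units.val_one]
      exact Metric.mem_ball_self hδ0)
  refine Filter.mem_of_superset hT ?_
  intro u hu
  rw [Set.mem_preimage, Metric.mem_ball, dist_eq_norm] at hu
  have hu4 : ‖(u : v.adicCompletion K) - 1‖ < ‖(4 : v.adicCompletion K)‖ := lt_of_lt_of_le hu (min_le_left _ _)
  have hu2 : ‖(u : v.adicCompletion K) - 1‖ < ‖(2 : v.adicCompletion K)‖ * ε := lt_of_lt_of_le hu (min_le_right _ _)
  obtain ⟨β, hβu, hβ⟩ := exists_sq_eq_of_norm_sub_one_lt K v hu4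
  have hβ0 : β ≠ 0 := by
    rintro rfl
    exact u.ne_zero (by rw [← hβu]; ring)
  have hβε : ‖β - 1‖ < ε :=
    lt_of_mul_lt_mul_left (lt_of_le_of_lt hβ hu2) (norm_nonneg _)
  have hβV : (Units.mk0 β hβ0 : (v.adicCompletion K)ˣ) ∈ (Units.val ⁻¹' V : Set (v.adicCompletion K)ˣ) := by
    rw [Set.mem_preimage, Units.val_mk0]
    exact hball (by rw [Metric.mem_ball, dist_eq_norm]; exact hβε)
  have hmem := hVsub hβV
  rw [Set.mem_preimage, Set.mem_preimage, localReducedNorm_unitsMap_algebraMap] at hmem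
  have hsq : (Units.mk0 β hβ0 : (v.adicCompletion K)ˣ) ^ 2 = u :=
    Units.ext (by rw [Units.val_pow_eq_pow_val, Units.val_mk0, hβu])
  rwa [hsq] at hmem

/-- **`H¹_v` has open complement classes ∕ `K_vˣ ⧸ n(H_vˣ)` is trivial and `n` is a quotient map**: `n : H_vˣ → K_vˣ` is an open quotient map
(continuous ★ `continuous_localReducedNorm`, open, surjective). [cite: VignerasLNM800, Ch. II §1 p. 31 (3); Lemme 1.4] -/
theorem isOpenQuotientMap_localReducedNorm : IsOpenQuotientMap (localReducedNorm K D v) :=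
  ⟨localReducedNorm_surjective K D v, continuous_localReducedNorm K D v, isOpenMap_localReducedNorm K D v⟩

end Local

end Literature.NumberTheory.K2Lit.QuaternionLocalNormOneSurjective

end
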